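import Literature.Barriers.CriticalPhenomena.TimarCutExhaustion
import Literature.Barriers.CriticalPhenomena.NonunimodularMTPQuasiTransitive
import HarnessLib

/-!
# The cut route to Timár 2006, Thm. 5.5 on QUASI-TRANSITIVE graphs: the cut-count mass transport
# and "a pointing forest of out-degree `≥ 3` on finite classes admits no exhaustion" — PROVED
# (abstract form)

Barrier catalogue `Literature/Barriers/CriticalPhenomena/`; the quasi-transitive twins of the two
abstract results of the cut route (`TimarCutTransport.lean`: `measure_le_mul_lintegral_cut`;
`TimarCutExhaustion.lean`: `measure_mem_eq_zero_of_cut_exhaustion`), which are the endgame of the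
tree's proof of Timár's Thm. 5.5 (Á. Timár, *Percolation on nonunimodular transitive graphs*,
Ann. Probab. 34 (2006) 2344–2364, §5, proof of Thm. 5.5, p. 2360) and are stated there for a
TRANSITIVE graph because they use the nonunimodular Mass-Transport Principle in its one-vertex
random form (`lintegral_tsum_eq_inv_autWeight_mul`). On a quasi-transitive graph the MTP holds for
the random root spread over a complete set `R` of orbit representatives with weights `w(o_i)⁻¹`
(`sum_inv_autWeight_mul_lintegral_tsum_eq_tilted`, `NonunimodularMTPQuasiTransitive.lean`, the
tilted form of Lyons–Peres 2016, (8.10)/(8.12)); accordingly the two results become statements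
about SUMS OVER `R`, which is all the contradiction needs:

* `sum_measure_le_mul_sum_lintegral_cut` — for equivariant points `D`, finite classes `cls` with
  the weight bound `w(x) ≤ B w(y)` inside a class, and cut counts `cut` satisfying the deficit
  `|cls x| ≤ Σ_{y ∈ cls x} cut(y)`:
  `Σ_{r ∈ R} P(r ∈ D) ≤ C · Σ_{r ∈ R} E[cut(r); r ∈ D]` with the finite constant
  `C = B · max_R w · (min_R w)⁻¹` (the deterministic core `autWeight_le_mul_tsum_cutTransport`
  and the class-averaging `cutTransport` of `TimarCutTransport.lean` are reused verbatim);
* `measure_mem_eq_zero_of_cut_exhaustion_quasiTransitive` — if moreover the pointing graph is an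
  equivariant forest with `3 ≤ #targets ≤ N` at the points and every out-edge is eventually
  inside the class of its tail in probability, then `P(x ∈ D) = 0` for EVERY vertex `x` (the sum
  over `R` tends to `0`, and invariance moves a representative to any vertex of its orbit).

## References

* Á. Timár, Ann. Probab. 34 (2006) 2344–2364 (arXiv:math/0702875), §5: proof of Thm. 5.5 (the
  forest, degrees `≥ 3`, the exhaustion `R_i`, the final contradiction), Lemma 5.1 (proof: the
  cluster-averaging transport), Lemma 2.2. [Timar2006]
* R. Lyons, Y. Peres, *Probability on Trees and Networks*, CUP 2016, §8.2 ((8.10), Cor. 8.11,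
  (8.12)), Exercise 7.3. [LyonsPeres2016]
* T. Hutchcroft, C. R. Math. Acad. Sci. Paris 354 (2016) 944–947, §2 (Timár's theorem in the
  quasi-transitive setting). [Hutchcroft2016]
-/

noncomputable section

namespace Literature.Barriers.CriticalPhenomena

open _root_.MeasureTheory _root_.Filter Literature.Probability.Percolation SimpleGraph Finset
open scoped _root_.ENNReal _root_.Topology

variable {V : Type*} {Ω : Type*} [MeasurableSpace Ω] {G : SimpleGraph V} [G.LocallyFinite]

/-! ### The extreme weights of the representatives -/

section Weights

variable (G) in
/-- The largest weight of a representative. [folklore] -/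
def repWeightMax (o : V) (R : Finset V) (hR : R.Nonempty) : ℝ≥0∞ := R.sup' hR (autWeight G o)

variable (G) in
/-- The least weight of a representative. [folklore] -/
def repWeightMin (o : V) (R : Finset V) (hR : R.Nonempty) : ℝ≥0∞ := R.inf' hR (autWeight G o)

omit [G.LocallyFinite] in
/-- `w(r) ≤ max_R w` for `r ∈ R`. [folklore] -/
theorem autWeight_le_repWeightMax (o : V) {R : Finset V} (hR : R.Nonempty) {r : V} (hr : r ∈ R) :
    autWeight G o r ≤ repWeightMax G o R hR :=
  Finset.le_sup' (autWeight G o) hr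

omit [G.LocallyFinite] in
/-- `min_R w ≤ w(r)` for `r ∈ R`. [folklore] -/
theorem repWeightMin_le_autWeight (o : V) {R : Finset V} (hR : R.Nonempty) {r : V} (hr : r ∈ R) :
    repWeightMin G o R hR ≤ autWeight G o r :=
  Finset.inf'_le (autWeight G o) hr

/-- `max_R w < ∞`. [folklore] -/
theorem repWeightMax_ne_top (hconn : G.Connected) (o : V) {R : Finset V} (hR : R.Nonempty) :
    repWeightMax G o R hR ≠ ⊤ := by
  obtain ⟨r, hr, h⟩ := Finset.exists_mem_eq_sup' hR (autWeight G o)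
  rw [repWeightMax, h]
  exact autWeight_ne_top G hconn o r

/-- `min_R w ≠ 0`. [folklore] -/
theorem repWeightMin_ne_zero (hconn : G.Connected) (o : V) {R : Finset V} (hR : R.Nonempty) :
    repWeightMin G o R hR ≠ 0 := by
  obtain ⟨r, hr, h⟩ := Finset.exists_mem_eq_inf' hR (autWeight G o)
  rw [repWeightMin, h]
  exact autWeight_ne_zero G hconn o r

/-- `min_R w < ∞`. [folklore] -/
theorem repWeightMin_ne_top (hconn : G.Connected) (o : V) {R : Finset V} (hR : R.Nonempty) :
    repWeightMin G o R hR ≠ ⊤ := by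
  obtain ⟨r, hr, h⟩ := Finset.exists_mem_eq_inf' hR (autWeight G o)
  rw [repWeightMin, h]
  exact autWeight_ne_top G hconn o r

/-- **The weight of any vertex is at most `max_R w` times its relative weight**:
`w(y) = Δ(y) w(o(y)) ≤ Δ(y) · max_R w`. [cite: LyonsPeres2016, Thm. 8.10 (weights unique up to a constant multiple)] -/
theorem autWeight_le_relWeight_mul_repWeightMax (hconn : G.Connected) (o : V) {R : Finset V}
    (hR : ∀ v : V, ∃ r ∈ R, v ∈ autOrbit G r) (hRne : R.Nonempty) (y : V) :
    autWeight G o y ≤ relWeight G R y * repWeightMax G o R hRne := by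
  rw [← relWeight_mul_autWeight_orbitRep hconn R o y]
  exact mul_le_mul' le_rfl (autWeight_le_repWeightMax o hRne (orbitRep_mem hR y))

end Weights

/-! ### The cut-count MTP, quasi-transitive form -/

section Invariant

variable [Countable V]

/-- **The cut-count MTP on a quasi-transitive graph, PROVED (abstract form).** Let `P` be a
measure on `Ω` preserved by measurable maps `act γ`, `γ ∈ Aut(G)`, of a connected, locally finite
graph `G` with a finite complete set `R` of orbit representatives (weights `w = autWeight G o`).
Let `D`, `cls`, `cut` be measurable and equivariant as in `measure_le_mul_lintegral_cut`, with,
almost surely for every `x ∈ D`: `x ∈ cls x ⊆ D`, the classes partition `D`, `cls x` finite,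
`w(x) ≤ B w(y)` on `cls x`, and the deficit `|cls x| ≤ Σ_{y ∈ cls x} cut(y)`. Then

  `Σ_{r ∈ R} P(r ∈ D) ≤ (B · max_R w · (min_R w)⁻¹) · Σ_{r ∈ R} E[cut(r); r ∈ D]`.

Proof: for every `r ∈ R`, `w(r) 1[r ∈ D] ≤ B Σ_y T(y, r) w(y) ≤ B max_R w · Σ_y T(y, r) Δ(y)`
(`autWeight_le_mul_tsum_cutTransport`); divide by `w(r)`, sum, and apply the quasi-transitive
tilted MTP `Σ_r w(r)⁻¹ E[Σ_y T(y, r) Δ(y)] = Σ_r w(r)⁻¹ E[Σ_y T(r, y)] = Σ_r w(r)⁻¹ E[cut(r); r ∈ D]`.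
[cite: Timar2006, Thm. 5.5 (proof: final contradiction) and Lemma 5.1 (proof), Lemma 2.2]
[cite: LyonsPeres2016, §8.2 ((8.10), Cor. 8.11)] -/
theorem sum_measure_le_mul_sum_lintegral_cut (hconn : G.Connected) (R : Finset V)
    (hR : ∀ v : V, ∃ r ∈ R, v ∈ autOrbit G r)
    (hR' : ∀ r ∈ R, ∀ r' ∈ R, r' ∈ autOrbit G r → r = r') (hRne : R.Nonempty)
    (μ : Measure Ω) (act : (G ≃g G) → Ω → Ω) (hact : ∀ γ, Measurable (act γ))
    (hμ : ∀ γ, μ.map (act γ) = μ) {D : Ω → Set V} {cls : Ω → V → Set V} {cut : Ω → V → ℝ≥0∞}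
    (hDm : ∀ x, MeasurableSet {ξ | x ∈ D ξ}) (hclsm : ∀ x y, MeasurableSet {ξ | y ∈ cls ξ x})
    (hcutm : ∀ x, Measurable fun ξ => cut ξ x)
    (hDinv : ∀ γ ξ x, γ x ∈ D (act γ ξ) ↔ x ∈ D ξ)
    (hclsinv : ∀ γ ξ x y, γ y ∈ cls (act γ ξ) (γ x) ↔ y ∈ cls ξ x)
    (hcutinv : ∀ γ ξ x, cut (act γ ξ) (γ x) = cut ξ x) (o : V) {B : ℝ≥0∞}
    (hgood : ∀ᵐ ξ ∂μ, ∀ x ∈ D ξ, x ∈ cls ξ x ∧ cls ξ x ⊆ D ξ ∧ (∀ y ∈ cls ξ x, cls ξ y = cls ξ x) ∧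
      (cls ξ x).Finite ∧ (∀ y ∈ cls ξ x, autWeight G o x ≤ B * autWeight G o y) ∧
      ((cls ξ x).encard : ℝ≥0∞) ≤ ∑' y, (cls ξ x).indicator (cut ξ) y) :
    ∑ r ∈ R, μ {ξ | r ∈ D ξ} ≤
      (B * repWeightMax G o R hRne * (repWeightMin G o R hRne)⁻¹) *
        ∑ r ∈ R, ∫⁻ ξ, {ξ | r ∈ D ξ}.indicator (fun ξ => cut ξ r) ξ ∂μ := by
  classical
  set T : V → V → Ω → ℝ≥0∞ := fun x y ξ => cutTransport (D ξ) (cls ξ) (cut ξ) x y with hT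
  have hTm : ∀ x y, Measurable (T x y) := fun x y => measurable_cutTransport hDm hclsm hcutm x y
  have hTinv : ∀ (γ : G ≃g G) (x y : V) (ξ : Ω), T (γ x) (γ y) (act γ ξ) = T x y ξ :=
    fun γ x y ξ => cutTransport_equivariant hDinv hclsinv hcutinv γ x y ξ
  have hmtp := sum_inv_autWeight_mul_lintegral_tsum_eq_tilted G hconn R hR hR' μ act hact hμ hTm
    hTinv o
  set Wmax := repWeightMax G o R hRne with hWmax
  set Wmin := repWeightMin G o R hRne with hWmin
  have hWmaxT := repWeightMax_ne_top hconn o hRne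
  have hWmin0 := repWeightMin_ne_zero hconn o hRne
  have hWminT := repWeightMin_ne_top hconn o hRne
  -- left side at `r`: a.s. `Σ_y T(r, y) = cut(r) 1[r ∈ D]`
  have hleft : ∀ r, ∫⁻ ξ, {ξ | r ∈ D ξ}.indicator (fun ξ => cut ξ r) ξ ∂μ = ∫⁻ ξ, ∑' y, T r y ξ ∂μ := by
    intro r
    refine lintegral_congr_ae ?_
    filter_upwards [hgood] with ξ hξ
    by_cases hxD : r ∈ D ξ
    · obtain ⟨hxx, -, -, hfin, -, -⟩ := hξ r hxD
      rw [Set.indicator_of_mem (show ξ ∈ {ξ | r ∈ D ξ} from hxD), hT,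
        tsum_cutTransport_of_mem (cut ξ) hxD hxx hfin]
    · rw [Set.indicator_of_notMem (show ξ ∉ {ξ | r ∈ D ξ} from hxD), hT,
        tsum_cutTransport_of_notMem (cut ξ) hxD]
  -- right side at `r`: `w(r) P(r ∈ D) ≤ B Wmax E[Σ_y T(y, r) Δ(y)]`
  have hright : ∀ r, autWeight G o r * μ {ξ | r ∈ D ξ} ≤
      B * Wmax * ∫⁻ ξ, ∑' y, T y r ξ * relWeight G R y ∂μ := by
    intro r
    have hmeas : Measurable fun ξ => ∑' y, T y r ξ * relWeight G R y :=
      measurable_tsum_ennreal fun y => (hTm y r).mul_const _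
    calc autWeight G o r * μ {ξ | r ∈ D ξ}
        = ∫⁻ ξ, {ξ | r ∈ D ξ}.indicator (fun _ => autWeight G o r) ξ ∂μ := by
          rw [lintegral_indicator_const (hDm r)]
      _ ≤ ∫⁻ ξ, B * Wmax * ∑' y, T y r ξ * relWeight G R y ∂μ := by
          refine lintegral_mono_ae ?_
          filter_upwards [hgood] with ξ hξ
          by_cases hxD : r ∈ D ξ
          · obtain ⟨-, hsub, -, hfin, htilt, hdef⟩ := hξ r hxD
            rw [Set.indicator_of_mem (show ξ ∈ {ξ | r ∈ D ξ} from hxD)]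
            have h1 := autWeight_le_mul_tsum_cutTransport (cut ξ) o hxD (fun y hy => (hξ y hy).1)
              hsub (fun y hy z hz => ((hξ y hy).2.2.1) z hz) hfin htilt hdef
            refine h1.trans ?_
            rw [mul_assoc]
            refine mul_le_mul' le_rfl ?_
            rw [← ENNReal.tsum_mul_left]
            refine ENNReal.tsum_le_tsum fun y => ?_
            calc cutTransport (D ξ) (cls ξ) (cut ξ) y r * autWeight G o y
                ≤ cutTransport (D ξ) (cls ξ) (cut ξ) y r * (relWeight G R y * Wmax) :=
                  mul_le_mul' le_rfl (autWeight_le_relWeight_mul_repWeightMax hconn o hR hRne y)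
              _ = Wmax * (T y r ξ * relWeight G R y) := by simp only [hT]; ring
          · rw [Set.indicator_of_notMem (show ξ ∉ {ξ | r ∈ D ξ} from hxD)]
            exact zero_le
      _ = B * Wmax * ∫⁻ ξ, ∑' y, T y r ξ * relWeight G R y ∂μ := lintegral_const_mul _ hmeas
  -- divide by `w(r)`, sum over `R`, apply the MTP, and bound `w(r)⁻¹ ≤ Wmin⁻¹`
  have hstep : ∀ r ∈ R, μ {ξ | r ∈ D ξ} ≤
      B * Wmax * ((autWeight G o r)⁻¹ * ∫⁻ ξ, ∑' y, T y r ξ * relWeight G R y ∂μ) := by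
    intro r _
    have h0 := autWeight_ne_zero G hconn o r
    have hTop := autWeight_ne_top G hconn o r
    calc μ {ξ | r ∈ D ξ} = (autWeight G o r)⁻¹ * (autWeight G o r * μ {ξ | r ∈ D ξ}) := by
          rw [← mul_assoc, ENNReal.inv_mul_cancel h0 hTop, one_mul]
      _ ≤ (autWeight G o r)⁻¹ * (B * Wmax * ∫⁻ ξ, ∑' y, T y r ξ * relWeight G R y ∂μ) :=
          mul_le_mul' le_rfl (hright r)
      _ = B * Wmax * ((autWeight G o r)⁻¹ * ∫⁻ ξ, ∑' y, T y r ξ * relWeight G R y ∂μ) := by ring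
  calc ∑ r ∈ R, μ {ξ | r ∈ D ξ}
      ≤ ∑ r ∈ R, B * Wmax * ((autWeight G o r)⁻¹ * ∫⁻ ξ, ∑' y, T y r ξ * relWeight G R y ∂μ) :=
        Finset.sum_le_sum hstep
    _ = B * Wmax * ∑ r ∈ R, (autWeight G o r)⁻¹ * ∫⁻ ξ, ∑' y, T r y ξ ∂μ := by
        rw [← Finset.mul_sum, hmtp]
    _ ≤ B * Wmax * ∑ r ∈ R, Wmin⁻¹ * ∫⁻ ξ, ∑' y, T r y ξ ∂μ := by
        gcongr with r hr
        exact repWeightMin_le_autWeight o hRne hr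
    _ = B * Wmax * Wmin⁻¹ * ∑ r ∈ R, ∫⁻ ξ, {ξ | r ∈ D ξ}.indicator (fun ξ => cut ξ r) ξ ∂μ := by
        rw [← Finset.mul_sum, ← mul_assoc]
        congr 1
        exact Finset.sum_congr rfl fun r _ => (hleft r).symm

omit [G.LocallyFinite] [Countable V] in
/-- Invariance moves the probability of `{x ∈ D}` along orbits. [folklore] -/
theorem measure_mem_eq_of_mem_autOrbit (μ : Measure Ω) (act : (G ≃g G) → Ω → Ω)
    (hact : ∀ γ, Measurable (act γ)) (hμ : ∀ γ, μ.map (act γ) = μ) {D : Ω → Set V}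
    (hDm : ∀ x, MeasurableSet {ξ | x ∈ D ξ}) (hDinv : ∀ γ ξ x, γ x ∈ D (act γ ξ) ↔ x ∈ D ξ)
    {r x : V} (hx : x ∈ autOrbit G r) : μ {ξ | x ∈ D ξ} = μ {ξ | r ∈ D ξ} := by
  obtain ⟨γ, rfl⟩ := hx
  have hpre : act γ ⁻¹' {ξ | γ r ∈ D ξ} = {ξ | r ∈ D ξ} := by
    ext ξ
    exact hDinv γ ξ r
  rw [← hpre, ← Measure.map_apply (hact γ) (hDm (γ r)), hμ γ]

omit [Countable V] in
/-- **The cut route to Thm. 5.5 on a quasi-transitive graph: no exhaustion of a pointing forest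
of out-degree `≥ 3` on finite classes, PROVED (abstract form).** As
`measure_mem_eq_zero_of_cut_exhaustion`, for a connected, locally finite, QUASI-transitive graph
(a finite measure `μ` preserved by measurable maps `act γ`; equivariant measurable points `D`,
pointing relation `P`, classes `cls i` partitioning `D` into finite classes with the weight bound
`w(x) ≤ B w(y)`, `B < ∞`; the pointing graph an equivariant forest with `3 ≤ #targets ≤ N` at the
points; and the exhaustion "`P(x → t, t ∉ cls_i(x)) → 0`"): then `P(x ∈ D) = 0` for every vertex
`x`. [cite: Timar2006, Thm. 5.5 (proof: the exhaustion R_i and the final contradiction)]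
[cite: Hutchcroft2016, §2 (quasi-transitive setting)] -/
theorem measure_mem_eq_zero_of_cut_exhaustion_quasiTransitive (hconn : G.Connected)
    (hqt : IsQuasiTransitive G) (μ : Measure Ω) [IsFiniteMeasure μ] (act : (G ≃g G) → Ω → Ω)
    (hact : ∀ γ, Measurable (act γ)) (hμ : ∀ γ, μ.map (act γ) = μ) {D : Ω → Set V}
    {P : Ω → V → V → Prop} {cls : ℕ → Ω → V → Set V} (hDm : ∀ x, MeasurableSet {ξ | x ∈ D ξ})
    (hPm : ∀ x t, MeasurableSet {ξ | P ξ x t})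
    (hclsm : ∀ i x y, MeasurableSet {ξ | y ∈ cls i ξ x})
    (hDinv : ∀ γ ξ x, γ x ∈ D (act γ ξ) ↔ x ∈ D ξ)
    (hPinv : ∀ γ ξ x t, P (act γ ξ) (γ x) (γ t) ↔ P ξ x t)
    (hclsinv : ∀ i γ ξ x y, γ y ∈ cls i (act γ ξ) (γ x) ↔ y ∈ cls i ξ x) (o : V) {B : ℝ≥0∞}
    (hBT : B ≠ ⊤) (N : ℕ)
    (hcls : ∀ᵐ ξ ∂μ, ∀ i, ∀ x ∈ D ξ, x ∈ cls i ξ x ∧ cls i ξ x ⊆ D ξ ∧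
      (∀ y ∈ cls i ξ x, cls i ξ y = cls i ξ x) ∧ (cls i ξ x).Finite ∧
      ∀ y ∈ cls i ξ x, autWeight G o x ≤ B * autWeight G o y)
    (hforest : ∀ᵐ ξ ∂μ, (pointGraph (P ξ)).IsAcyclic ∧ (∀ a b, P ξ a b → a ≠ b) ∧
      (∀ x ∈ D ξ, 3 ≤ ({t | P ξ x t} : Set V).encard) ∧
      ∀ x, ({t | P ξ x t} : Set V).encard ≤ N)
    (hexh : ∀ x t, Tendsto (fun i => μ {ξ | P ξ x t ∧ t ∉ cls i ξ x}) atTop (𝓝 0)) (x : V) :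
    μ {ξ | x ∈ D ξ} = 0 := by
  classical
  haveI : Countable V := countable_of_connected_of_locallyFinite G hconn o
  obtain ⟨R, hR, hR'⟩ := hqt.exists_orbit_representatives
  have hRne : R.Nonempty := by obtain ⟨r, hr, -⟩ := hR o; exact ⟨r, hr⟩
  -- the cut counts
  set cut : ℕ → Ω → V → ℝ≥0∞ := fun i ξ y =>
    (({t | P ξ y t ∧ t ∉ cls i ξ y} : Set V).encard : ℝ≥0∞) with hcut
  have hcut_tsum : ∀ i ξ y, cut i ξ y = ∑' t, ({t | P ξ y t ∧ t ∉ cls i ξ y} : Set V).indicator 1 t := by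
    intro i ξ y
    rw [show (1 : V → ℝ≥0∞) = fun _ => 1 from rfl, tsum_indicator_const, mul_one]
  have hEm : ∀ i y t, MeasurableSet {ξ | P ξ y t ∧ t ∉ cls i ξ y} := fun i y t =>
    (hPm y t).inter (hclsm i y t).compl
  have hcutm : ∀ i y, Measurable fun ξ => cut i ξ y := by
    intro i y
    simp_rw [hcut_tsum]
    refine measurable_tsum_ennreal fun t => measurable_one.indicator ?_
    exact hEm i y t
  have hcutinv : ∀ i γ ξ y, cut i (act γ ξ) (γ y) = cut i ξ y := by
    intro i γ ξ y
    have hset : ({t | P (act γ ξ) (γ y) t ∧ t ∉ cls i (act γ ξ) (γ y)} : Set V) =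
        (γ : V → V) '' {t | P ξ y t ∧ t ∉ cls i ξ y} := by
      ext t
      constructor
      · intro h
        refine ⟨γ.symm t, ?_, γ.apply_symm_apply t⟩
        have h' := h
        rw [← γ.apply_symm_apply t] at h'
        exact ⟨(hPinv γ ξ y _).1 h'.1, fun hm => h'.2 ((hclsinv i γ ξ y _).2 hm)⟩
      · rintro ⟨t', ht', rfl⟩
        exact ⟨(hPinv γ ξ y t').2 ht'.1, fun hm => ht'.2 ((hclsinv i γ ξ y t').1 hm)⟩
    simp only [hcut]
    rw [hset, γ.injective.encard_image]
  -- Step A: `Σ_r P(r ∈ D) ≤ C · Σ_r E[cut_i(r)]`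
  set C : ℝ≥0∞ := B * repWeightMax G o R hRne * (repWeightMin G o R hRne)⁻¹ with hC
  have hCT : C ≠ ⊤ := ENNReal.mul_ne_top (ENNReal.mul_ne_top hBT (repWeightMax_ne_top hconn o hRne))
    (ENNReal.inv_ne_top.2 (repWeightMin_ne_zero hconn o hRne))
  have hgood : ∀ i, ∀ᵐ ξ ∂μ, ∀ y ∈ D ξ, y ∈ cls i ξ y ∧ cls i ξ y ⊆ D ξ ∧
      (∀ z ∈ cls i ξ y, cls i ξ z = cls i ξ y) ∧ (cls i ξ y).Finite ∧
      (∀ z ∈ cls i ξ y, autWeight G o y ≤ B * autWeight G o z) ∧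
      ((cls i ξ y).encard : ℝ≥0∞) ≤ ∑' z, (cls i ξ y).indicator (cut i ξ) z := by
    intro i
    filter_upwards [hcls, hforest] with ξ h1 h2 y hy
    obtain ⟨hyy, hsub, hpart, hfin, htilt⟩ := h1 i y hy
    refine ⟨hyy, hsub, hpart, hfin, htilt, ?_⟩
    have hdef := encard_le_tsum_indicator_cutCount h2.1 h2.2.1 hfin ⟨y, hyy⟩
      (fun z hz => h2.2.2.1 z (hsub hz))
    refine hdef.trans (le_of_eq (tsum_congr fun z => ?_))
    by_cases hz : z ∈ cls i ξ y
    · rw [Set.indicator_of_mem hz, Set.indicator_of_mem hz]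
      simp only [cutCount, hcut]
      rw [hpart z hz]
    · rw [Set.indicator_of_notMem hz, Set.indicator_of_notMem hz]
  have hA : ∀ i, ∑ r ∈ R, μ {ξ | r ∈ D ξ} ≤ C * ∑ r ∈ R, ∫⁻ ξ, cut i ξ r ∂μ := by
    intro i
    refine (sum_measure_le_mul_sum_lintegral_cut hconn R hR hR' hRne μ act hact hμ hDm (hclsm i)
      (hcutm i) hDinv (hclsinv i) (hcutinv i) o (hgood i)).trans ?_
    refine mul_le_mul' le_rfl (Finset.sum_le_sum fun r _ => ?_)
    exact lintegral_mono fun ξ => Set.indicator_le_self _ _ ξ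
  -- Step B: `E[cut_i(r)] → 0` for every vertex `r`
  have hcut_ind : ∀ i ξ y, cut i ξ y =
      ∑' t, ({ξ' | P ξ' y t ∧ t ∉ cls i ξ' y} : Set Ω).indicator (1 : Ω → ℝ≥0∞) ξ := by
    intro i ξ y
    rw [hcut_tsum]
    refine tsum_congr fun t => ?_
    simp only [Set.indicator_apply, Set.mem_setOf_eq, Pi.one_apply]
  have hB : ∀ y : V, Tendsto (fun i => ∫⁻ ξ, cut i ξ y ∂μ) atTop (𝓝 0) := by
    intro y
    have hint : ∀ i, ∫⁻ ξ, cut i ξ y ∂μ = ∑' t, μ {ξ | P ξ y t ∧ t ∉ cls i ξ y} := by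
      intro i
      rw [lintegral_congr fun ξ => hcut_ind i ξ y,
        lintegral_tsum fun t => (measurable_one.indicator (hEm i y t)).aemeasurable]
      exact tsum_congr fun t => lintegral_indicator_one (hEm i y t)
    have hbound : ∑' t, μ {ξ | P ξ y t} ≠ ⊤ := by
      have h2 : ∀ ξ, (({t | P ξ y t} : Set V).encard : ℝ≥0∞) =
          ∑' t, ({ξ' | P ξ' y t} : Set Ω).indicator (1 : Ω → ℝ≥0∞) ξ := by
        intro ξ
        rw [show (({t | P ξ y t} : Set V).encard : ℝ≥0∞) = ∑' t, ({t | P ξ y t} : Set V).indicator 1 t by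
          rw [show (1 : V → ℝ≥0∞) = fun _ => 1 from rfl, tsum_indicator_const, mul_one]]
        refine tsum_congr fun t => ?_
        simp only [Set.indicator_apply, Set.mem_setOf_eq, Pi.one_apply]
      have h1 : ∑' t, μ {ξ | P ξ y t} = ∫⁻ ξ, (({t | P ξ y t} : Set V).encard : ℝ≥0∞) ∂μ := by
        rw [lintegral_congr fun ξ => h2 ξ,
          lintegral_tsum fun t => (measurable_one.indicator (hPm y t)).aemeasurable]
        exact (tsum_congr fun t => lintegral_indicator_one (hPm y t)).symm
      rw [h1]
      refine ne_top_of_le_ne_top (ENNReal.mul_ne_top (ENNReal.natCast_ne_top N)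
        (measure_ne_top μ Set.univ)) ?_
      calc ∫⁻ ξ, (({t | P ξ y t} : Set V).encard : ℝ≥0∞) ∂μ ≤ ∫⁻ _ξ, (N : ℝ≥0∞) ∂μ := by
            refine lintegral_mono_ae ?_
            filter_upwards [hforest] with ξ hξ
            exact_mod_cast hξ.2.2.2 y
        _ = N * μ Set.univ := lintegral_const _
    simp_rw [hint]
    exact tendsto_tsum_measure_of_dominated (fun i t => measure_mono fun ξ hξ => hξ.1) hbound
      (hexh y)
  -- Step C: the sum over `R` is `0`, hence every term, hence every vertex
  have hlim : Tendsto (fun i => C * ∑ r ∈ R, ∫⁻ ξ, cut i ξ r ∂μ) atTop (𝓝 0) := by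
    have h := tendsto_finsetSum R fun r _ => hB r
    rw [Finset.sum_const_zero] at h
    simpa only [mul_zero] using ENNReal.Tendsto.const_mul h (Or.inr hCT)
  have hsum0 : ∑ r ∈ R, μ {ξ | r ∈ D ξ} = 0 := le_zero_iff.1 (ge_of_tendsto' hlim hA)
  obtain ⟨r, hr, hxr⟩ := hR x
  rw [measure_mem_eq_of_mem_autOrbit μ act hact hμ hDm hDinv hxr]
  exact (Finset.sum_eq_zero_iff.1 hsum0) r hr

end Invariant

end Literature.Barriers.CriticalPhenomena

end
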